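import Literature.Computability.Cryptography.RegevReductionCVPqProgParse
import Literature.Computability.Cryptography.RegevReductionCVPqProgBlock
import Literature.Computability.Complexity.CodeFPOfUnary
import Literature.Computability.Complexity.CodeFPListKit
import Literature.Computability.Complexity.ListFoldBricks
import Literature.Computability.Complexity.TM2PassThrough
import HarnessLib

/-!
# Regev's CVP_q programs, III: the block-manufacture program `manuf`

HONEST FRAMING. Part of a first formalisation of a KNOWN reduction (Regev 2009, worst-case
GapSVP/SIVP ≤ LWE, classical part). The value is a THEOREM about that reduction (plumbing: the input
manufacture of Regev's `CVP_q` procedure — from the query `x`, a block pointer `e_j` and the block's coins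
`c` to the code of the shifted batch of LWE samples handed to the LWE oracle — is ONE polynomial-time
string function, and on genuine inputs it returns exactly the tree's specification `blockInput`). It is
NOT progress on any open problem and breaks nothing.

## What is proved

* `denomL`, `sclL` (+ `denomL_ofFn`, `sclL_ofFn`) — the scale `N₀(t) = 2∏ den tⱼ` and the integers
  `N₀ tⱼ` from the list of the `tⱼ`; `padVarQ_eq` — the padding variance of a block from its level;
* `manufL` — the whole manufacture as a list program on the typed view `(query data, e_j ++ c)`, and
  `codeFP_manufL` — it is polynomial-time, given polynomial-time parameters `q, m, a` and sampler;
* `manufL_spec` — on `(qOf I ρ k t w, e_j ++ c)` its code IS `blockInput q m a samp pc I hI t w hP j c`;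
* `exists_manuf` — hence a string function `manuf ∈ FP` with
  `manuf ((x ++ e_j) ++ c) = blockInput …` (the `manuf`/`manuf_mem_FP`/`manuf_spec` fields of
  `Regev2009.CVPqPrograms`, for any `pK` bounding the number of blocks).

## Sources

Regev 2009 (J. ACM 56(6):34; pages from arXiv:2401.03703): Lemma 3.11 p. 18 (the procedure and its
samples, Eq. (10)), Lemma 3.7 p. 16, Lemma 4.1 (shift of the secret). Arora–Barak 2009 §1.3 (closure of
polynomial time under composition and bounded loops), Def. 7.1 (coins as an auxiliary input).
-/

noncomputable section

namespace Literature.Computability.Cryptography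

namespace Regev2009

namespace CVPqProg

open _root_.Computability Literature.Computability.Complexity Literature.Computability.Complexity.CodeFP
  Literature.Computability.Complexity.Brick Literature.Algebra.EuclideanLattices Polynomial Finset
  Literature.LinearAlgebra.Matrix Literature.LinearAlgebra.Matrix.RowSelect Peikert2009 LWE DigitOracle

variable {α β γ σ : Type} {eα : α → List Bool} {eβ : β → List Bool} {eσ : σ → List Bool}

/-! ### The scale `N₀(t)` and the scaled point from the list of the `tⱼ` -/

/-- `N₀ = 2 ∏ⱼ den(tⱼ)` from the list. [cite: RegevLWE2009, Lemma 3.11 (proof: clearing denominators)] -/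
def denomL (ts : List ℚ) : ℕ := 2 * (ts.map Rat.den).prod

/-- `denomL` is the tree's `denom`. [folklore] -/
theorem denomL_ofFn {k : ℕ} (t : Fin k → ℚ) : denomL (List.ofFn t) = denom t := by
  rw [denomL, denom, List.map_ofFn, List.prod_ofFn]; rfl

/-- The integers `N₀ tⱼ = 2 (∏_{i ≠ j} den tᵢ) num tⱼ`, computed as `2 ((∏ᵢ den tᵢ) / den tⱼ) num tⱼ`.
[cite: RegevLWE2009, Lemma 3.11 (proof)] -/
def sclL (ts : List ℚ) : List ℤ := ts.map fun tj => 2 * ((((ts.map Rat.den).prod : ℕ) : ℤ) / (tj.den : ℤ)) * tj.num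

/-- `sclL` is the tree's `scaled`. [folklore] -/
theorem sclL_ofFn {k : ℕ} (t : Fin k → ℚ) : sclL (List.ofFn t) = List.ofFn (scaled t) := by
  rw [sclL, List.map_ofFn]
  congr 1; funext j
  simp only [Function.comp_apply, List.map_ofFn, List.prod_ofFn, scaled]
  congr 2
  have h := Finset.mul_prod_erase univ (fun i => ((t i).den : ℤ)) (mem_univ j)
  push_cast
  rw [← h, Int.mul_ediv_cancel_left _ (by exact_mod_cast (t j).den_nz)]

/-- `denomL` on codes. [cite: AroraBarak2009, §1.3] -/
theorem codeFP_denomL : CodeFP (rawE encodeRat) natE denomL := by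
  have hprod : CodeFP (pairE unitE (rawE natE)) natE (fun p => p.2.prod) :=
    of_fn Brick.prodListFn Brick.prodListFn_mem_FP fun p => by
      rw [pairE_apply, Brick.prodListFn_boolPair, decNil_rawE, List.map_map]
      congr 1
      refine congrArg List.prod ?_
      rw [List.map_congr_left (fun a _ => ?_), List.map_id]
      exact bitsToNat_natE a
  have hdens : CodeFP (rawE encodeRat) (rawE natE) (fun ts => ts.map Rat.den) := (map₀ (ratNumDen.snd' :) :)
  exact (natMul.comp ((const _ (2 : ℕ)).pair (hprod.comp ((const _ ()).pair hdens)))).congr fun _ => rfl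

/-- `sclL` on codes. [cite: AroraBarak2009, §1.3] -/
theorem codeFP_sclL : CodeFP (rawE encodeRat) (rawE intE) sclL := by
  have hprod : CodeFP (pairE unitE (rawE natE)) natE (fun p => p.2.prod) :=
    of_fn Brick.prodListFn Brick.prodListFn_mem_FP fun p => by
      rw [pairE_apply, Brick.prodListFn_boolPair, decNil_rawE, List.map_map]
      congr 1
      refine congrArg List.prod ?_
      rw [List.map_congr_left (fun a _ => ?_), List.map_id]
      exact bitsToNat_natE a
  have hD : CodeFP (rawE encodeRat) intE (fun ts => (((ts.map Rat.den).prod : ℕ) : ℤ)) :=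
    (intOfNat.comp (hprod.comp ((const _ ()).pair (map₀ (ratNumDen.snd' :) :))) :)
  have hg : CodeFP (pairE intE encodeRat) intE (fun t => 2 * (t.1 / (t.2.den : ℤ)) * t.2.num) :=
    (intMul.comp ((intMul.comp ((const _ (2 : ℤ)).pair (intEDiv.comp ((fst _ _).pair
      (intOfNat.comp (ratNumDen.comp (snd _ _)).snd'))))).pair (ratNumDen.comp (snd _ _)).fst') :)
  exact ((map (σ := ℤ) (eσ := intE) (eα := encodeRat) (g := fun t => 2 * (t.1 / (t.2.den : ℤ)) * t.2.num) hg).comp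
    (hD.pair (CodeFP.id _))).congr fun _ => rfl

/-! ### Block parameters -/

/-- The padding variance of a block at level `g`: `a²/2 + g · a²/K_g`. [cite: RegevLWE2009, Lemma 3.7 (proof)] -/
def padVarQ (a : ℚ) (Kg g : ℕ) : ℚ := a ^ 2 / 2 + (g : ℚ) * (a ^ 2 / Kg)

/-- The level of block `j` is `j / J`. [folklore] -/
theorem padVarQ_eq (a : ℚ) (Kg J : ℕ) (j : Fin ((Kg + 1) * J)) : padVarQ a Kg (j / J) = padVar a Kg J j := by
  rw [padVarQ, padVar, finProdFinEquiv_symm_apply, Fin.coe_divNat]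

/-- `padVarQ` on codes `(a, (Kg, g))`. [cite: AroraBarak2009, §1.3] -/
theorem codeFP_padVarQ : CodeFP (pairE encodeRat (pairE natE natE)) encodeRat (fun p => padVarQ p.1 p.2.1 p.2.2) := by
  have ha2 : CodeFP (pairE encodeRat (pairE natE natE)) encodeRat (fun p => p.1 ^ 2) :=
    (ratMul.comp ((fst _ _).pair (fst _ _))).congr fun p => (sq p.1).symm
  have hg : CodeFP (pairE encodeRat (pairE natE natE)) encodeRat (fun p => (p.2.2 : ℚ)) :=
    (ratOfIntNat.comp ((intOfNat.comp (snd _ _).snd').pair (const _ (1 : ℕ)))).congr fun p => by simp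
  have hK : CodeFP (pairE encodeRat (pairE natE natE)) encodeRat (fun p => (p.2.1 : ℚ)) :=
    (ratOfIntNat.comp ((intOfNat.comp (snd _ _).fst').pair (const _ (1 : ℕ)))).congr fun p => by simp
  exact (ratAdd.comp ((ratDiv.comp (ha2.pair (const _ (2 : ℚ)))).pair
    (ratMul.comp (hg.pair (ratDiv.comp (ha2.pair hK)))))).congr fun _ => rfl

/-- The verification count `N_V(n) = 2 · (800000 (n + 1))`. [cite: RegevLWE2009, Lemma 3.6] -/
theorem nVerify_eq (n : ℕ) : nVerify n = 2 * (800000 * (n + 1)) := rfl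

/-- **The parameter tuple of block `j`** `((q, K, n, N), (M_c, M_f, s_c, s_f), (ℓ_U, L_c, L_f))` from
`q = q(n)`, `m = m(n)`, `a = α(n)`, the dimension `n`, the scale `N` and the block index `j`.
[cite: RegevLWE2009, Lemma 3.11 (proof) with Lemma 3.7 (proof)] -/
def blockParams (pc : Polynomial ℕ) (q' m' : ℕ) (a' : ℚ) (n N j : ℕ) :
    (ℕ × ℕ × ℕ × ℕ) × (ℕ × ℕ × ℚ × ℚ) × (ℕ × ℕ × ℕ) :=
  ((q', 512, n, N),
    (q' * N, q' * 512 * N, padVarQ a' (24 * m' + 1) (j / (n + 1)), a' ^ 2 / 2),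
    (Nat.size q' + n, coinLen pc (q' * N) (padVarQ a' (24 * m' + 1) (j / (n + 1))) n,
      coinLen pc (q' * 512 * N) (a' ^ 2 / 2) n))

/-- The block list program on its tuple `(params, (vectors, coins))`. [folklore] -/
def blockT (samp : List Bool → List Bool)
    (x : ((ℕ × ℕ × ℕ × ℕ) × (ℕ × ℕ × ℚ × ℚ) × (ℕ × ℕ × ℕ)) × ((List ℤ × List (List ℤ) × List (List ℤ)) × List Bool)) :
    (List ℕ × List (List ℕ × ℕ)) × List (List ℕ × ℕ) :=
  blockL samp x.1.1.1 x.1.1.2.1 x.1.1.2.2.1 x.1.1.2.2.2 x.1.2.1.1 x.1.2.1.2.1 x.1.2.1.2.2.1 x.1.2.1.2.2.2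
    x.1.2.2.1 x.1.2.2.2.1 x.1.2.2.2.2 x.2.1.1 x.2.1.2.1 x.2.1.2.2 x.2.2

/-- `blockT` on an explicit tuple. [folklore] -/
theorem blockT_mk (samp : List Bool → List Bool) (q' K n N Mc Mf : ℕ) (sc sf : ℚ) (ℓU Lc Lf : ℕ) (scl : List ℤ)
    (cv fv : List (List ℤ)) (r : List Bool) :
    blockT samp (((q', K, n, N), ((Mc, Mf, sc, sf), (ℓU, Lc, Lf))), ((scl, cv, fv), r)) =
      blockL samp q' K n N Mc Mf sc sf ℓU Lc Lf scl cv fv r := rfl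

/-- `blockT` on codes. [cite: AroraBarak2009, §1.3] -/
theorem codeFP_blockT {samp : List Bool → List Bool} (hsamp : samp ∈ FP) :
    CodeFP (pairE bparE (pairE bvecE strE)) boutE (blockT samp) := (codeFP_blockL hsamp).congr fun _ => rfl

/-! ### The manufacture as a list program -/

/-- Row-basis coordinates of every batch item. [cite: MicciancioGoldwasser2002, Ch. 1 §1.1] -/
def coordsL (rows : List (List ℤ)) (batch : List (ℕ × List ℤ)) : List (List ℤ) := batch.map fun item => reprL rows item.2

/-- **The value lists of block `j`** on parsed data — dimension `n`, basis rows, batch, point list,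
block index `j`, coins `r` ↦ `((shift residues, coarse samples), fine samples)` — the list form of the
tree's `blockData`. [cite: RegevLWE2009, Lemma 3.11 (proof) with Lemma 3.7 (proof)] -/
def blockVals (q m : ℕ → ℕ) (a : ℕ → ℚ) (samp : List Bool → List Bool) (pc : Polynomial ℕ) (n : ℕ)
    (rows : List (List ℤ)) (batch : List (ℕ × List ℤ)) (ts : List ℚ) (j : ℕ) (r : List Bool) :
    (List ℕ × List (List ℕ × ℕ)) × List (List ℕ × ℕ) :=
  blockT samp (blockParams pc (q n) (m n) (a n) n (denomL ts) j,
    (sclL ts, ((coordsL rows batch).drop (j * (m n + nVerify n))).take (m n),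
      ((coordsL rows batch).drop (j * (m n + nVerify n) + m n)).take (nVerify n)), r)

/-- **The core of the manufacture**: `(n, q, shifted coarse batch of block j)` (residues).
[cite: RegevLWE2009, Lemma 3.11 (proof) with Lemma 4.1 (proof)] -/
def manufCore (q m : ℕ → ℕ) (a : ℕ → ℚ) (samp : List Bool → List Bool) (pc : Polynomial ℕ) (n : ℕ)
    (rows : List (List ℤ)) (batch : List (ℕ × List ℤ)) (ts : List ℚ) (j : ℕ) (c : List Bool) :
    ℕ × ℕ × List (List ℕ × ℕ) :=
  (n, q n, shiftedL (q n) (blockVals q m a samp pc n rows batch ts j c).1.1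
    (blockVals q m a samp pc n rows batch ts j c).1.2)

/-- The block index read off the pointer `e_j` (the position of its `true` among `K` width-1 chunks).
[folklore] -/
def idxOf (K : ℕ) (e : List Bool) : ℕ := (wordsL 1 K e).findIdx fun w => decide (w = [true])

/-- **The manufacture** on the typed view `(d, rest)` of its input `x ++ (e_j ++ c)`: `K = p_K(|x|) + 1`,
`e_j = rest.take K`, `c = rest.drop K`. [cite: RegevLWE2009, Lemma 3.11 (proof)] -/
def manufL (q m : ℕ → ℕ) (a : ℕ → ℚ) (samp : List Bool → List Bool) (pc pK : Polynomial ℕ) (d : QData)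
    (rest : List Bool) : ℕ × ℕ × List (List ℕ × ℕ) :=
  manufCore q m a samp pc d.1.1.1.n (GapCodes.matRows d.1.1.1.basis) d.1.2.2 d.2
    (idxOf (pK.eval (qE d).length + 1) (rest.take (pK.eval (qE d).length + 1)))
    (rest.drop (pK.eval (qE d).length + 1))

/-- The output code: `⟨bin n, ⟨bin q, list of (list of residues, residue)⟩⟩`. [cite: Regev2009, §2] -/
abbrev outE : ℕ × ℕ × List (List ℕ × ℕ) → List Bool := pairE natE (pairE natE (listE (pairE (listE natE) natE)))

/-! ### Correctness on genuine inputs -/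

/-- The pointer's index. [folklore] -/
theorem idxOf_indicator (K j : ℕ) (hj : j < K) :
    idxOf K (List.ofFn fun j' : Fin K => decide ((j' : ℕ) = j)) = j := by
  have hw : wordsL 1 K (List.ofFn fun j' : Fin K => decide ((j' : ℕ) = j)) =
      List.ofFn fun i : Fin K => [decide ((i : ℕ) = j)] := by
    rw [wordsL]
    congr 1; funext i
    rw [chunk]
    apply List.ext_getElem
    · simp; omega
    · intro l h₁ h₂
      simp at h₂
      subst h₂
      simp
  rw [idxOf, hw, List.findIdx_eq (by simp; exact hj)]
  refine ⟨by simp, fun l hl => ?_⟩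
  simp
  omega

/-- `coordsL` on a genuine batch lists the row-basis coordinates. [folklore] -/
theorem coordsL_ofFn (I : LatticeInstance) [IsZLattice ℝ I.lattice] {P : ℕ} (w : Fin P → I.lattice) :
    coordsL (GapCodes.matRows I.basis) (List.ofFn fun i => (I.n, List.ofFn (I.intCoords (w i)))) =
      List.ofFn fun i => List.ofFn fun l => (zBasis I).repr (w i) l := by
  rw [coordsL, List.map_ofFn]
  congr 1; funext i
  exact reprL_intCoords I (w i)

/-- **The block lists are the residues of the tree's `blockData`** on genuine data (any coins `r`).
[cite: RegevLWE2009, Lemma 3.11 (proof) with Lemma 3.7 (proof)] -/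
theorem blockVals_eq (q : ℕ → ℕ) [∀ n, NeZero (q n)] (m : ℕ → ℕ) (a : ℕ → ℚ) (samp : List Bool → List Bool)
    (pc : Polynomial ℕ) (I : LatticeInstance) (hI : I.IsNonsingular) (t : Fin I.n → ℚ) {P : ℕ}
    (w : Fin P → I.lattice) (hP : nVectors (m I.n) I.n ≤ P) (j : Fin (nBlk m I.n)) (r : List Bool) :
    blockVals q m a samp pc I.n (GapCodes.matRows I.basis) (List.ofFn fun i => (I.n, List.ofFn (I.intCoords (w i))))
      (List.ofFn t) j r = valsOf (blockData q m a samp pc I hI t w hP j r) := by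
  haveI := I.isZLattice_of_isNonsingular hI
  rw [blockVals, coordsL_ofFn, denomL_ofFn, sclL_ofFn]
  -- the two windows of the batch are block `j`
  have hwin : ∀ (s len : ℕ) (g : Fin len → Fin P) (hg : ∀ i, (g i : ℕ) = s + i) (h : s + len ≤ P),
      ((List.ofFn fun i : Fin P => List.ofFn fun l => (zBasis I).repr (w i) l).drop s).take len =
        List.ofFn fun i : Fin len => List.ofFn fun l => (zBasis I).repr (w (g i)) l := by
    intro s len g hg h
    apply List.ext_getElem (by simp; omega)
    intro i h₁ h₂
    have key : ∀ i' : Fin len, w (g i') = w ⟨s + i', by have := i'.2; omega⟩ := fun i' =>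
      congrArg w (Fin.ext (by rw [hg]))
    simp only [List.getElem_take, List.getElem_drop, List.getElem_ofFn, key]
  have hblk : (j : ℕ) * (m I.n + nVerify I.n) + (m I.n + nVerify I.n) ≤ P := by
    have h1 : ((j : ℕ) + 1) * (m I.n + nVerify I.n) ≤ nBlk m I.n * (m I.n + nVerify I.n) :=
      Nat.mul_le_mul_right _ j.2
    have h2 : nBlk m I.n * (m I.n + nVerify I.n) = nVectors (m I.n) I.n := by
      rw [nBlk, nVectors]
    rw [Nat.succ_mul] at h1
    omega
  -- (the index identities are proved by `rw`, keeping the kernel away from the schedule's literals)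
  rw [hwin ((j : ℕ) * (m I.n + nVerify I.n)) (m I.n)
      (fun i => Fin.castLE hP (finProdFinEquiv (m := nBlk m I.n) (n := m I.n + nVerify I.n) (j, Fin.castAdd (nVerify I.n) i)))
      (fun i => by rw [Fin.val_castLE, finProdFinEquiv_apply_val, Fin.val_castAdd]; ring) (by omega),
    hwin ((j : ℕ) * (m I.n + nVerify I.n) + m I.n) (nVerify I.n)
      (fun i => Fin.castLE hP (finProdFinEquiv (m := nBlk m I.n) (n := m I.n + nVerify I.n) (j, Fin.natAdd (m I.n) i)))
      (fun i => by rw [Fin.val_castLE, finProdFinEquiv_apply_val, Fin.val_natAdd]; ring) (by omega)]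
  -- the parameters are the tree's, and the block program computes the residues of `blockData`
  have hpar : blockParams pc (q I.n) (m I.n) (a I.n) I.n (denom t) j =
      ((q I.n, schedK, I.n, denom t), (q I.n * denom t, q I.n * schedK * denom t,
        padVar (a I.n) (nLevels (m I.n)) (schedJ I.n) j, (a I.n) ^ 2 / 2),
        (Nat.size (q I.n) + I.n, coinLen pc (q I.n * denom t) (padVar (a I.n) (nLevels (m I.n)) (schedJ I.n) j) I.n,
          coinLen pc (q I.n * schedK * denom t) ((a I.n) ^ 2 / 2) I.n)) := by
    rw [blockParams, ← padVarQ_eq]; rfl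
  -- the block lemma of module 8b, with `blocksOf` unfolded so that both sides match syntactically
  have key := blockL_eq I (q I.n) schedK (m I.n) (nVerify I.n) samp pc (q I.n * denom t)
    (padVar (a I.n) (nLevels (m I.n)) (schedJ I.n) j) (q I.n * schedK * denom t) ((a I.n) ^ 2 / 2)
    (Nat.size (q I.n) + I.n) (denom t) t (blocksOf (nBlk m I.n) (m I.n + nVerify I.n) (fun i => w (Fin.castLE hP i)) j) r
  simp only [blocksOf] at key
  rw [hpar, blockT_mk, key]
  rfl

/-- **The manufacture is correct**: on the typed view of `x ++ (e_j ++ c)` it returns the data whose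
code is `blockInput`. [cite: RegevLWE2009, Lemma 3.11 (proof) with Lemma 3.7, Lemma 4.1 (proofs)] -/
theorem manufL_spec (q : ℕ → ℕ) [∀ n, NeZero (q n)] (m : ℕ → ℕ) (a : ℕ → ℚ) (samp : List Bool → List Bool)
    (pc pK : Polynomial ℕ) (I : LatticeInstance) (hI : I.IsNonsingular) (ρ : ℚ) (k : ℕ) (t : Fin I.n → ℚ)
    {P : ℕ} (w : Fin P → I.lattice) (hP : nVectors (m I.n) I.n ≤ P) (j : Fin (nBlk m I.n))
    (hK : nBlk m I.n ≤ pK.eval (queryOf I ρ k t w).length + 1) (c : List Bool) :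
    outE (manufL q m a samp pc pK (qOf I ρ k t w)
      ((List.ofFn fun j' : Fin (pK.eval (queryOf I ρ k t w).length + 1) => decide ((j' : ℕ) = (j : ℕ))) ++ c)) =
      blockInput q m a samp pc I hI t w hP j c := by
  have hX : (qE (qOf I ρ k t w)).length = (queryOf I ρ k t w).length := by rw [qE_qOf]
  have hjK : (j : ℕ) < pK.eval (qE (qOf I ρ k t w)).length + 1 := by rw [hX]; exact lt_of_lt_of_le j.2 hK
  -- the pointer and the coins
  rw [manufL, hX, List.take_left' (by simp), List.drop_left' (by simp), idxOf_indicator _ _ (hX ▸ hjK)]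
  -- the parsed data and the block
  rw [show (qOf I ρ k t w).1.1.1 = I from rfl, show (qOf I ρ k t w).2 = List.ofFn t from rfl,
    show (qOf I ρ k t w).1.2.2 = List.ofFn (fun i => (I.n, List.ofFn (I.intCoords (w i)))) from rfl, manufCore,
    blockVals_eq q m a samp pc I hI t w hP j c, blockInput, encodeLWESamples_eq, valsOf, shiftedL_ofFn]

/-! ### The programs are polynomial-time -/

/-- Input code of the manufacture on its typed view. [folklore] -/
abbrev mE : QData × List Bool → List Bool := pairE qE strE

/-- Code of the core data `(n, rows, batch, ts, j, r)` (`n` unary). [folklore] -/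
abbrev coreE : (ℕ × List (List ℤ) × List (ℕ × List ℤ) × List ℚ × ℕ × List Bool) → List Bool :=
  pairE unE (pairE (rawE (rawE intE)) (pairE (rawE (pairE natE (listE smE))) (pairE (rawE encodeRat) (pairE natE strE))))

/-- `coordsL` on codes `(rows, batch)`. [cite: AroraBarak2009, §1.3] -/
theorem codeFP_coordsL : CodeFP (pairE (rawE (rawE intE)) (rawE (pairE natE (listE smE)))) (rawE (rawE intE))
    (fun p => coordsL p.1 p.2) := by
  have hu : CodeFP (pairE natE (listE smE)) (rawE intE) (fun item => item.2) :=
    ((map₀ intOfSM).comp ((rawOfList smE).comp (snd _ _))).congr fun item => by simp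
  have hitem : CodeFP (pairE (rawE (rawE intE)) (pairE natE (listE smE))) (rawE intE) (fun t => reprL t.1 t.2.2) :=
    (codeFP_reprL.comp ((fst _ _).pair (hu.comp (snd _ _))) :)
  exact (map (σ := List (List ℤ)) (eσ := rawE (rawE intE)) (eα := pairE natE (listE smE)) (eβ := rawE intE)
    (g := fun t => reprL t.1 t.2.2) hitem).congr fun _ => rfl

/-- **A window of a list**: `((j, 1ᵘ), (1ᵒ, 1ˡ, L)) ↦ (L.drop (j·u + o)).take l` (`j` binary, capped at `|L|`).
[cite: AroraBarak2009, §1.3] -/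
theorem codeFP_window (eα : α → List Bool) :
    CodeFP (pairE (pairE natE unE) (pairE unE (pairE unE (rawE eα)))) (rawE eα)
      (fun x => (x.2.2.2.drop (x.1.1 * x.1.2 + x.2.1)).take x.2.2.1) := by
  have cL : CodeFP (pairE (pairE natE unE) (pairE unE (pairE unE (rawE eα)))) (rawE eα) (fun x => x.2.2.2) := (snd _ _).snd'.snd'
  have cjU : CodeFP (pairE (pairE natE unE) (pairE unE (pairE unE (rawE eα)))) unE (fun x => min x.1.1 x.2.2.2.length) :=
    (unOfNatMin.comp (((ulength eα).comp cL).pair (fst _ _).fst') :)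
  have cunMul : CodeFP (pairE unE unE) unE (fun p => p.1 * p.2) :=
    _root_.Literature.Computability.QuantumComplexity.unMul_codeFP
  have coff : CodeFP (pairE (pairE natE unE) (pairE unE (pairE unE (rawE eα)))) unE
      (fun x => min x.1.1 x.2.2.2.length * x.1.2 + x.2.1) :=
    (unAdd.comp ((cunMul.comp (cjU.pair (fst _ _).snd')).pair (snd _ _).fst') :)
  have h : CodeFP (pairE (pairE natE unE) (pairE unE (pairE unE (rawE eα)))) (rawE eα)
      (fun x => (x.2.2.2.drop (min x.1.1 x.2.2.2.length * x.1.2 + x.2.1)).take x.2.2.1) :=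
    ((rawTakeUn eα).comp ((snd _ _).snd'.fst'.pair ((rawDropUn eα).comp (coff.pair cL))) :)
  refine h.congr fun x => ?_
  -- `min j |L| · u + o` and `j · u + o` select the same window
  rcases le_total x.1.1 x.2.2.2.length with hle | hle
  · rw [min_eq_left hle]
  · rw [min_eq_right hle]
    rcases Nat.eq_zero_or_pos x.1.2 with hu | hu
    · simp [hu]
    · rw [← List.drop_drop, ← List.drop_drop (l := x.2.2.2),
        List.drop_of_length_le (Nat.le_mul_of_pos_right _ hu),
        List.drop_of_length_le (le_trans hle (Nat.le_mul_of_pos_right _ hu))]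

/-- A window without offset: `((j, 1ᵘ), (1ˡ, L)) ↦ (L.drop (j·u)).take l`. [cite: AroraBarak2009, §1.3] -/
theorem codeFP_window₀ (eα : α → List Bool) :
    CodeFP (pairE (pairE natE unE) (pairE unE (rawE eα))) (rawE eα) (fun x => (x.2.2.drop (x.1.1 * x.1.2)).take x.2.1) :=
  ((codeFP_window eα).comp ((fst _ _).pair ((const _ (0 : ℕ)).pair (snd _ _)))).congr fun _ => rfl

/-- **The block parameters are polynomial-time** in `((q, m, a), (1ⁿ, N, j))`. [cite: AroraBarak2009, §1.3] -/
theorem codeFP_blockParams (pc : Polynomial ℕ) :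
    CodeFP (pairE (pairE natE (pairE natE encodeRat)) (pairE unE (pairE natE natE))) bparE
      (fun x => blockParams pc x.1.1 x.1.2.1 x.1.2.2 x.2.1 x.2.2.1 x.2.2.2) := by
  have cq : CodeFP (pairE (pairE natE (pairE natE encodeRat)) (pairE unE (pairE natE natE))) natE (fun x => x.1.1) := (fst _ _).fst'
  have cm : CodeFP (pairE (pairE natE (pairE natE encodeRat)) (pairE unE (pairE natE natE))) natE (fun x => x.1.2.1) :=
    (fst _ _).snd'.fst'
  have ca : CodeFP (pairE (pairE natE (pairE natE encodeRat)) (pairE unE (pairE natE natE))) encodeRat (fun x => x.1.2.2) :=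
    (fst _ _).snd'.snd'
  have cn : CodeFP (pairE (pairE natE (pairE natE encodeRat)) (pairE unE (pairE natE natE))) unE (fun x => x.2.1) := (snd _ _).fst'
  have cN : CodeFP (pairE (pairE natE (pairE natE encodeRat)) (pairE unE (pairE natE natE))) natE (fun x => x.2.2.1) :=
    (snd _ _).snd'.fst'
  have cj : CodeFP (pairE (pairE natE (pairE natE encodeRat)) (pairE unE (pairE natE natE))) natE (fun x => x.2.2.2) :=
    (snd _ _).snd'.snd'
  have cKg : CodeFP (pairE (pairE natE (pairE natE encodeRat)) (pairE unE (pairE natE natE))) natE (fun x => 24 * x.1.2.1 + 1) :=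
    (natAdd.comp ((natMul.comp ((const _ (24 : ℕ)).pair cm)).pair (const _ (1 : ℕ))) :)
  have cg : CodeFP (pairE (pairE natE (pairE natE encodeRat)) (pairE unE (pairE natE natE))) natE (fun x => x.2.2.2 / (x.2.1 + 1)) :=
    (natDiv.comp (cj.pair (natOfUn.comp (unSucc.comp cn))) :)
  have csc : CodeFP (pairE (pairE natE (pairE natE encodeRat)) (pairE unE (pairE natE natE))) encodeRat
      (fun x => padVarQ x.1.2.2 (24 * x.1.2.1 + 1) (x.2.2.2 / (x.2.1 + 1))) :=
    (codeFP_padVarQ.comp (ca.pair (cKg.pair cg)) :)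
  have csf : CodeFP (pairE (pairE natE (pairE natE encodeRat)) (pairE unE (pairE natE natE))) encodeRat (fun x => x.1.2.2 ^ 2 / 2) :=
    (ratDiv.comp ((ratMul.comp (ca.pair ca)).pair (const _ (2 : ℚ)))).congr fun x => by rw [sq]
  have cMc : CodeFP (pairE (pairE natE (pairE natE encodeRat)) (pairE unE (pairE natE natE))) natE (fun x => x.1.1 * x.2.2.1) :=
    (natMul.comp (cq.pair cN) :)
  have cMf : CodeFP (pairE (pairE natE (pairE natE encodeRat)) (pairE unE (pairE natE natE))) natE (fun x => x.1.1 * 512 * x.2.2.1) :=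
    (natMul.comp ((natMul.comp (cq.pair (const _ (512 : ℕ)))).pair cN) :)
  have cU : CodeFP (pairE (pairE natE (pairE natE encodeRat)) (pairE unE (pairE natE natE))) unE (fun x => Nat.size x.1.1 + x.2.1) :=
    (unAdd.comp (((codeLenU natE).comp cq).pair cn)).congr fun x => by
      simp [TM2Pass.length_encodeNat_eq_size]
  have cLc : CodeFP (pairE (pairE natE (pairE natE encodeRat)) (pairE unE (pairE natE natE))) unE
      (fun x => coinLen pc (x.1.1 * x.2.2.1) (padVarQ x.1.2.2 (24 * x.1.2.1 + 1) (x.2.2.2 / (x.2.1 + 1))) x.2.1) :=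
    ((codePolyLenU (pairE natE (pairE encodeRat unE)) pc).comp (cMc.pair (csc.pair cn))).congr fun _ => rfl
  have cLf : CodeFP (pairE (pairE natE (pairE natE encodeRat)) (pairE unE (pairE natE natE))) unE
      (fun x => coinLen pc (x.1.1 * 512 * x.2.2.1) (x.1.2.2 ^ 2 / 2) x.2.1) :=
    ((codePolyLenU (pairE natE (pairE encodeRat unE)) pc).comp (cMf.pair (csf.pair cn))).congr fun _ => rfl
  exact ((cq.pair ((const _ (512 : ℕ)).pair (cn.pair cN))).pair ((cMc.pair (cMf.pair (csc.pair csf))).pair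
    (cU.pair (cLc.pair cLf)))).congr fun _ => rfl

/-- **The block lists are polynomial-time in the core data** (parameters `q, m, a` polynomial-time in
unary `n`, `m` polynomially bounded, sampler in `FP`). [cite: AroraBarak2009, §1.3] -/
theorem codeFP_blockVals {q m : ℕ → ℕ} {a : ℕ → ℚ} {samp : List Bool → List Bool} (pc : Polynomial ℕ)
    (hq : PolyTimeComputable unaryEncodeNat encodeNat q) (hm : PolyTimeComputable unaryEncodeNat encodeNat m)
    (hpm : IsPolyBounded m) (ha : PolyTimeComputable unaryEncodeNat encodeRat a) (hsamp : samp ∈ FP) :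
    CodeFP coreE boutE (fun y => blockVals q m a samp pc y.1 y.2.1 y.2.2.1 y.2.2.2.1 y.2.2.2.2.1 y.2.2.2.2.2) := by
  obtain ⟨pm, hpm⟩ := hpm
  have cn : CodeFP coreE unE (fun y => y.1) := fst _ _
  have crows : CodeFP coreE (rawE (rawE intE)) (fun y => y.2.1) := (snd _ _).fst'
  have cbatch : CodeFP coreE (rawE (pairE natE (listE smE))) (fun y => y.2.2.1) := (snd _ _).snd'.fst'
  have cts : CodeFP coreE (rawE encodeRat) (fun y => y.2.2.2.1) := (snd _ _).snd'.snd'.fst'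
  have cj : CodeFP coreE natE (fun y => y.2.2.2.2.1) := (snd _ _).snd'.snd'.snd'.fst'
  have cr : CodeFP coreE strE (fun y => y.2.2.2.2.2) := (snd _ _).snd'.snd'.snd'.snd'
  have cq : CodeFP coreE natE (fun y => q y.1) := ((codeFP_natParam hq).comp cn :)
  have cmN : CodeFP coreE natE (fun y => m y.1) := ((codeFP_natParam hm).comp cn :)
  have cmU : CodeFP coreE unE (fun y => m y.1) :=
    (unOfNatMin.comp (((codePolyLenU unE pm).comp cn).pair cmN)).congr fun y => by
      simpa using (min_eq_left (hpm y.1)).symm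
  have cNVU : CodeFP coreE unE (fun y => nVerify y.1) :=
    ((unMulConst 2).comp ((unMulConst 800000).comp (unSucc.comp cn))).congr fun y => by rw [nVerify_eq]
  have ca : CodeFP coreE encodeRat (fun y => a y.1) := ((ofPolyTimeComputable_unE ha).comp cn :)
  have cN : CodeFP coreE natE (fun y => denomL y.2.2.2.1) := (codeFP_denomL.comp cts :)
  have cscl : CodeFP coreE (rawE intE) (fun y => sclL y.2.2.2.1) := (codeFP_sclL.comp cts :)
  have ccoords : CodeFP coreE (rawE (rawE intE)) (fun y => coordsL y.2.1 y.2.2.1) := (codeFP_coordsL.comp (crows.pair cbatch) :)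
  have cu : CodeFP coreE unE (fun y => m y.1 + nVerify y.1) := (unAdd.comp (cmU.pair cNVU) :)
  have cwin1 : CodeFP coreE (rawE (rawE intE))
      (fun y => ((coordsL y.2.1 y.2.2.1).drop (y.2.2.2.2.1 * (m y.1 + nVerify y.1))).take (m y.1)) :=
    ((codeFP_window₀ (rawE intE)).comp ((cj.pair cu).pair (cmU.pair ccoords))).congr fun _ => rfl
  have cwin2 : CodeFP coreE (rawE (rawE intE))
      (fun y => ((coordsL y.2.1 y.2.2.1).drop (y.2.2.2.2.1 * (m y.1 + nVerify y.1) + m y.1)).take (nVerify y.1)) :=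
    ((codeFP_window (rawE intE)).comp ((cj.pair cu).pair (cmU.pair (cNVU.pair ccoords))) :)
  have cpar : CodeFP coreE bparE (fun y => blockParams pc (q y.1) (m y.1) (a y.1) y.1 (denomL y.2.2.2.1) y.2.2.2.2.1) :=
    ((codeFP_blockParams pc).comp ((cq.pair (cmN.pair ca)).pair (cn.pair (cN.pair cj))) :)
  exact ((codeFP_blockT hsamp).comp (cpar.pair ((cscl.pair (cwin1.pair cwin2)).pair cr))).congr fun _ => rfl

/-- **The core of the manufacture is polynomial-time.** [cite: AroraBarak2009, §1.3] -/
theorem codeFP_manufCore {q m : ℕ → ℕ} {a : ℕ → ℚ} {samp : List Bool → List Bool} (pc : Polynomial ℕ)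
    (hq : PolyTimeComputable unaryEncodeNat encodeNat q) (hm : PolyTimeComputable unaryEncodeNat encodeNat m)
    (hpm : IsPolyBounded m) (ha : PolyTimeComputable unaryEncodeNat encodeRat a) (hsamp : samp ∈ FP) :
    CodeFP coreE outE (fun y => manufCore q m a samp pc y.1 y.2.1 y.2.2.1 y.2.2.2.1 y.2.2.2.2.1 y.2.2.2.2.2) := by
  have cB := codeFP_blockVals pc hq hm hpm ha hsamp
  have cn : CodeFP coreE unE (fun y => y.1) := fst _ _
  have cq : CodeFP coreE natE (fun y => q y.1) := ((codeFP_natParam hq).comp cn :)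
  have hitemOut : CodeFP (pairE (rawE natE) natE) (pairE (listE natE) natE) (fun ab => ab) :=
    (((listOfRaw natE).comp (fst _ _)).pair (snd _ _)).congr fun ab => by rcases ab with ⟨a, b⟩; rfl
  have hlist : CodeFP (rawE (pairE (rawE natE) natE)) (listE (pairE (listE natE) natE)) (fun l => l) :=
    ((listOfRaw (pairE (listE natE) natE)).comp (map₀ hitemOut)).congr fun l => by simp
  exact (((natOfUn.comp cn).pair (cq.pair (hlist.comp (codeFP_shiftedL.comp (cq.pair (cB.fst'.fst'.pair cB.fst'.snd')))))).congr
    fun _ => rfl :)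

/-- **The manufacture is polynomial-time.** [cite: AroraBarak2009, §1.3] -/
theorem codeFP_manufL {q m : ℕ → ℕ} {a : ℕ → ℚ} {samp : List Bool → List Bool} (pc pK : Polynomial ℕ)
    (hq : PolyTimeComputable unaryEncodeNat encodeNat q) (hm : PolyTimeComputable unaryEncodeNat encodeNat m)
    (hpm : IsPolyBounded m) (ha : PolyTimeComputable unaryEncodeNat encodeRat a) (hsamp : samp ∈ FP) :
    CodeFP mE outE (fun p => manufL q m a samp pc pK p.1 p.2) := by
  -- parsed fields
  have hinst : CodeFP mE GapSVPInstance.encode (fun p => p.1.1.1) := (fst _ _).fst'.fst'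
  have hn : CodeFP mE unE (fun p => p.1.1.1.1.n) := (GapCodes.svpNUn_codeFP.comp hinst :)
  have hrows : CodeFP mE (rawE (rawE intE)) (fun p => GapCodes.matRows p.1.1.1.1.basis) := (codeFP_matRows.comp hinst :)
  have hbatch : CodeFP mE (rawE (pairE natE (listE smE))) (fun p => p.1.1.2.2) := (fst _ _).fst'.snd'.snd'
  have hts : CodeFP mE (rawE encodeRat) (fun p => p.1.2) := ((rawOfList encodeRat).comp (fst _ _).snd' :)
  have hrest : CodeFP mE strE (fun p => p.2) := snd _ _
  -- `K = p_K(|x|) + 1`, pointer, coins, block index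
  have hK : CodeFP mE unE (fun p => pK.eval (qE p.1).length + 1) :=
    ((codePolyLenU qE (pK + 1)).comp (fst _ _)).congr fun p => by simp
  have he : CodeFP mE strE (fun p => p.2.take (pK.eval (qE p.1).length + 1)) := (strTake.comp (hK.pair hrest) :)
  have hc : CodeFP mE strE (fun p => p.2.drop (pK.eval (qE p.1).length + 1)) := (strDrop.comp (hK.pair hrest) :)
  have hpred : CodeFP (pairE unitE strE) bitE (fun t => decide (t.2 = [true])) :=
    ((CodeFP.eq (eα := strE) fun _ _ h => h).comp ((snd _ _).pair (const _ [true])) :)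
  have hj : CodeFP mE natE (fun p => idxOf (pK.eval (qE p.1).length + 1) (p.2.take (pK.eval (qE p.1).length + 1))) :=
    ((findIdxFP hpred).comp ((const _ ()).pair (codeFP_wordsL.comp ((const _ (1 : ℕ)).pair (hK.pair he))))).congr
      fun _ => rfl
  exact ((codeFP_manufCore pc hq hm hpm ha hsamp).comp (hn.pair (hrows.pair (hbatch.pair (hts.pair (hj.pair hc)))))).congr
    fun _ => rfl

/-! ### The `manuf` field of `CVPqPrograms` -/

/-- **The manufacture as ONE string function in `FP`** with the specification of
`Regev2009.CVPqPrograms.manuf_spec` (for any block-count bound `pK`; the coin-length hypothesis of the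
field is not needed). [cite: RegevLWE2009, Lemma 3.11 (proof)]; [cite: AroraBarak2009, §1.3, Def. 7.1] -/
theorem exists_manuf (q : ℕ → ℕ) [∀ n, NeZero (q n)] (m : ℕ → ℕ) (a : ℕ → ℚ) (samp : List Bool → List Bool)
    (pc pK : Polynomial ℕ) (hq : PolyTimeComputable unaryEncodeNat encodeNat q)
    (hm : PolyTimeComputable unaryEncodeNat encodeNat m) (hpm : IsPolyBounded m)
    (ha : PolyTimeComputable unaryEncodeNat encodeRat a) (hsamp : samp ∈ FP) :
    ∃ manuf : List Bool → List Bool, manuf ∈ FP ∧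
      ∀ (I : LatticeInstance) (hI : I.IsNonsingular) (ρ : ℚ) (k : ℕ) (t : Fin I.n → ℚ) (P : ℕ) (w : Fin P → I.lattice)
        (hP : nVectors (m I.n) I.n ≤ P) (j : Fin (nBlk m I.n)),
        nBlk m I.n ≤ pK.eval (queryOf I ρ k t w).length + 1 → ∀ c : List Bool,
        manuf ((queryOf I ρ k t w ++ List.ofFn fun j' : Fin (pK.eval (queryOf I ρ k t w).length + 1) =>
            decide ((j' : ℕ) = (j : ℕ))) ++ c) = blockInput q m a samp pc I hI t w hP j c := by
  obtain ⟨f, hf, hfe⟩ := (codeFP_manufL pc pK hq hm hpm ha hsamp).comp codeFP_unApp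
  refine ⟨f, hf, fun I hI ρ k t P w hP j hK c => ?_⟩
  have h := hfe (qOf I ρ k t w, (List.ofFn fun j' : Fin (pK.eval (queryOf I ρ k t w).length + 1) =>
    decide ((j' : ℕ) = (j : ℕ))) ++ c)
  rw [appE, qE_qOf, ← List.append_assoc] at h
  rw [h]
  exact manufL_spec q m a samp pc pK I hI ρ k t w hP j hK c

end CVPqProg

end Regev2009

end Literature.Computability.Cryptography
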